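import Literature.Probability.Process.PathSpaceBorel
import Literature.Probability.Process.ContinuousHitting
import Mathlib.Probability.IdentDistrib
import HarnessLib

/-!
# Exit functionals on the path space `C([0, ∞), ℝ)` and continuous-path processes

Topic `Probability/RandomPlanarGeometry` (support file for the Skorokhod embedding,
Lawler–Schramm–Werner (2004), Lemma 3.8 / Durrett (2019), Thms. 8.1.1, 8.2.1). Everything here is
PROVED; no named fact is introduced.

The Skorokhod embedding iterates the exit problem of `BrownianExitInterval` along the
post-`τ` Brownian motions `Z^τ_u = B_{τ+u} - B_τ` given by the strong Markov property
(`BrownianStrongMarkov`). Since the canonical Brownian motion `Process.brownian` is an opaque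
continuous modification of the coordinate process, functionals written in terms of
`Process.brownian` do not transfer to `Z^τ` through the path map; the standard remedy (Billingsley
(1999), §7: a continuous process is a random element of `C[0, ∞)`) is to express every functional
on the **path space `C(ℝ≥0, ℝ)`** and to pull it back along the path lift of any continuous-path
process. This file provides that dictionary:

* `coordProcess t p = p t`, the coordinate process on `C(ℝ≥0, ℝ)`, its natural filtration
  `coordFiltration`, and the exit functionals of an interval `(a, b)`: `pathExitTime a b`
  (a stopping time of `coordFiltration`, hence Borel measurable), `pathExitValue a b`,
  `pathExitTimeReal a b`, the pre-exit (stopped) path `preExitPath a b` and the post-exit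
  (shifted) path `postExitPath a b`, all Borel measurable;
* `toPathC Y hY ω = (t ↦ Y t ω)`, the path lift of a process with continuous paths (measurable as
  soon as the marginals are, `measurable_toPathC`), with the **lift lemmas**
  `exitTime_eq_pathExitTime_toPathC`, `stoppedValue_eq_pathExitValue_toPathC` (definitional);
* the **transfer lemma** `identDistrib_toPathC`: two continuous-path processes with the same law
  on `ℝ≥0 → ℝ` (product σ-algebra) have the same law on `C(ℝ≥0, ℝ)` (the Borel σ-algebra of the
  compact-open topology is the pull-back of the product σ-algebra,
  `Process.borel_continuousMap_eq_iSup_comap_eval`).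

The Borel structure on `C(ℝ≥0, ℝ)` is a section hypothesis `[MeasurableSpace C(ℝ≥0, ℝ)]
[BorelSpace C(ℝ≥0, ℝ)]` (compatible with the scoped instances `PathBorel.*` of
`SLETraceApproximation`).

## References

* P. Billingsley, *Convergence of Probability Measures*, 2nd ed. (1999), §7 (random functions).
* R. Durrett, *Probability: Theory and Examples*, 5th ed. (2019), Thm. 8.1.1, Thm. 8.2.1.
* G. F. Lawler, O. Schramm, W. Werner, Ann. Probab. 32 (2004), Lemma 3.8.
-/

noncomputable section

open MeasureTheory ProbabilityTheory Filter Set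
open scoped NNReal ENNReal Topology

namespace Literature.Probability.RandomPlanarGeometry

open Literature.Probability.Process

/-! ### The coordinate process on `C(ℝ≥0, ℝ)` and its exit functionals -/

/-- The **coordinate process** on the path space `C([0, ∞), ℝ)`: `coordProcess t p = p t`.
Billingsley (1999), §7. [folklore] -/
def coordProcess (t : ℝ≥0) (p : C(ℝ≥0, ℝ)) : ℝ := p t

/-- Unfolding of the coordinate process. [folklore] -/
@[simp] theorem coordProcess_apply (t : ℝ≥0) (p : C(ℝ≥0, ℝ)) : coordProcess t p = p t := rfl

/-- Every path of the coordinate process is continuous. [folklore] -/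
theorem continuous_coordProcess (p : C(ℝ≥0, ℝ)) : Continuous fun t ↦ coordProcess t p :=
  p.continuous

/-- The **exit time of `(a, b)`** as a functional on path space: the exit time of the coordinate
process (`⊤` if the path never leaves `(a, b)`; junk `0` if `b ≤ a`). Durrett (2019), Thm. 8.1.1
(`T_{a,b} = inf{t : B_t ∉ (a, b)}`). [folklore] -/
def pathExitTime (a b : ℝ) : C(ℝ≥0, ℝ) → WithTop ℝ≥0 :=
  Process.exitTime coordProcess a b

/-- The **exit value** `p(T_{a,b})` as a functional on path space (junk: the value at an
arbitrary time if the path never exits). [folklore] -/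
def pathExitValue (a b : ℝ) : C(ℝ≥0, ℝ) → ℝ :=
  stoppedValue coordProcess (pathExitTime a b)

/-- The **real-valued exit time** of `(a, b)` as a functional on path space (junk `0` if the path
never exits). [folklore] -/
def pathExitTimeReal (a b : ℝ) (p : C(ℝ≥0, ℝ)) : ℝ :=
  ((pathExitTime a b p).untopD 0 : ℝ≥0)

/-- The real-valued exit time is nonnegative. [folklore] -/
theorem pathExitTimeReal_nonneg (a b : ℝ) (p : C(ℝ≥0, ℝ)) : 0 ≤ pathExitTimeReal a b p :=
  NNReal.coe_nonneg _

/-- At a finite exit time `T`, the real-valued exit time is `T`. [folklore] -/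
theorem pathExitTimeReal_of_eq_coe {a b : ℝ} {p : C(ℝ≥0, ℝ)} {T : ℝ≥0}
    (hT : pathExitTime a b p = T) : pathExitTimeReal a b p = T := by
  simp only [pathExitTimeReal, hT]
  rfl

/-- At a finite exit time `T`, the exit value is `p T`. [folklore] -/
theorem pathExitValue_of_eq_coe {a b : ℝ} {p : C(ℝ≥0, ℝ)} {T : ℝ≥0}
    (hT : pathExitTime a b p = T) : pathExitValue a b p = p T := by
  simp only [pathExitValue, stoppedValue, hT]
  rfl

/-- **The exit value is an endpoint**: `p(T) = a` or `p(T) = b` when the path starts in `(a, b)`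
and exits at a finite time. [folklore] -/
theorem pathExitValue_eq_or_eq {a b : ℝ} {p : C(ℝ≥0, ℝ)} (h0 : p 0 ∈ Ioo a b)
    (hT : pathExitTime a b p ≠ ⊤) : pathExitValue a b p = a ∨ pathExitValue a b p = b := by
  obtain ⟨T, hT'⟩ := WithTop.ne_top_iff_exists.1 hT
  rw [pathExitValue_of_eq_coe hT'.symm]
  exact Process.apply_eq_or_eq_of_exitTime_eq_coe (u := coordProcess) (continuous_coordProcess p)
    h0 hT'.symm

/-- The **shifted path** `u ↦ p(s + u) - p(s)` (increments after time `s`). Le Gall (2016),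
Thm. 2.20 (`B^{(T)}_t = B_{T+t} - B_T`). [folklore] -/
def shiftPath (s : ℝ≥0) (p : C(ℝ≥0, ℝ)) : C(ℝ≥0, ℝ) :=
  ⟨fun u ↦ p (s + u) - p s, (p.continuous.comp (continuous_const.add continuous_id)).sub
    continuous_const⟩

/-- Unfolding of the shifted path. [folklore] -/
@[simp] theorem shiftPath_apply (s : ℝ≥0) (p : C(ℝ≥0, ℝ)) (u : ℝ≥0) :
    shiftPath s p u = p (s + u) - p s := rfl

/-- The **post-exit path** of `(a, b)`: the increments of `p` after its exit time of `(a, b)`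
(junk: shifted at an arbitrary time if the path never exits — the same convention as
`MeasureTheory.stoppedValue` and `brownianIncrAfter`). [folklore] -/
def postExitPath (a b : ℝ) (p : C(ℝ≥0, ℝ)) : C(ℝ≥0, ℝ) :=
  shiftPath (pathExitTime a b p).untopA p

/-- The **pre-exit path** of `(a, b)`: `p` stopped at its exit time of `(a, b)`, i.e. the path
`u ↦ p(u ∧ T_{a,b})` of Mathlib's `stoppedProcess` of the coordinate process (no junk: if the
path never exits, it is `p` itself). [folklore] -/
def preExitPath (a b : ℝ) (p : C(ℝ≥0, ℝ)) : C(ℝ≥0, ℝ) :=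
  ⟨fun u ↦ p (min (u : WithTop ℝ≥0) (pathExitTime a b p)).untopA,
    p.continuous.comp (Process.continuous_untopA_min_coe _)⟩

/-- The pre-exit path is the stopped coordinate process (definitional). [folklore] -/
theorem preExitPath_apply (a b : ℝ) (p : C(ℝ≥0, ℝ)) (u : ℝ≥0) :
    preExitPath a b p u = stoppedProcess coordProcess (pathExitTime a b) u p := rfl

/-- Unfolding of the post-exit path at a finite exit time. [folklore] -/
theorem postExitPath_apply_of_eq_coe {a b : ℝ} {p : C(ℝ≥0, ℝ)} {T : ℝ≥0}
    (hT : pathExitTime a b p = T) (u : ℝ≥0) : postExitPath a b p u = p (T + u) - p T := by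
  simp only [postExitPath, hT, shiftPath_apply]
  rfl

/-- Unfolding of the pre-exit path at a finite exit time. [folklore] -/
theorem preExitPath_apply_of_eq_coe {a b : ℝ} {p : C(ℝ≥0, ℝ)} {T : ℝ≥0}
    (hT : pathExitTime a b p = T) (u : ℝ≥0) : preExitPath a b p u = p (min u T) := by
  change p (min (u : WithTop ℝ≥0) (pathExitTime a b p)).untopA = p (min u T)
  rw [hT, ← WithTop.coe_min]
  rfl

/-! ### Path lifts of continuous-path processes -/

section Lift

variable {Ω : Type*} {mΩ : MeasurableSpace Ω}

/-- The **path lift** of a process `Y` all of whose paths are continuous: `ω ↦ (t ↦ Y t ω)` as an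
element of `C([0, ∞), ℝ)`. Billingsley (1999), §7 ("random functions"). [folklore] -/
def toPathC (Y : ℝ≥0 → Ω → ℝ) (hY : ∀ ω, Continuous fun t ↦ Y t ω) (ω : Ω) : C(ℝ≥0, ℝ) :=
  ⟨fun t ↦ Y t ω, hY ω⟩

/-- Unfolding of the path lift. [folklore] -/
@[simp] theorem toPathC_apply (Y : ℝ≥0 → Ω → ℝ) (hY : ∀ ω, Continuous fun t ↦ Y t ω) (ω : Ω)
    (t : ℝ≥0) : toPathC Y hY ω t = Y t ω := rfl

/-- **Lift lemma for the exit time**: the exit time of `(a, b)` by `Y` is the path exit time of the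
lifted path (both are `hittingAfter` of processes with the same path; definitional). [folklore] -/
theorem exitTime_eq_pathExitTime_toPathC (Y : ℝ≥0 → Ω → ℝ) (hY : ∀ ω, Continuous fun t ↦ Y t ω)
    (a b : ℝ) (ω : Ω) : Process.exitTime Y a b ω = pathExitTime a b (toPathC Y hY ω) := rfl

/-- **Lift lemma for the exit value** (definitional). [folklore] -/
theorem stoppedValue_eq_pathExitValue_toPathC (Y : ℝ≥0 → Ω → ℝ)
    (hY : ∀ ω, Continuous fun t ↦ Y t ω) (a b : ℝ) (ω : Ω) :
    stoppedValue Y (Process.exitTime Y a b) ω = pathExitValue a b (toPathC Y hY ω) := rfl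

/-- **Lift lemma for the stopped process** (definitional). [folklore] -/
theorem stoppedProcess_eq_preExitPath_toPathC (Y : ℝ≥0 → Ω → ℝ)
    (hY : ∀ ω, Continuous fun t ↦ Y t ω) (a b : ℝ) (t : ℝ≥0) (ω : Ω) :
    stoppedProcess Y (Process.exitTime Y a b) t ω = preExitPath a b (toPathC Y hY ω) t := rfl

variable [MeasurableSpace C(ℝ≥0, ℝ)] [BorelSpace C(ℝ≥0, ℝ)]

/-- **A continuous-path process with measurable marginals is a random element of path space**
(`Process.measurable_continuousMap_of_eval`). Billingsley (1999), §7. [folklore] -/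
theorem measurable_toPathC {Y : ℝ≥0 → Ω → ℝ} (hY : ∀ ω, Continuous fun t ↦ Y t ω)
    (hm : ∀ t, Measurable (Y t)) : Measurable (toPathC Y hY) := by
  have h := Process.measurable_continuousMap_of_eval (Φ := toPathC Y hY) (fun t ↦ hm t)
  rwa [← BorelSpace.measurable_eq (α := C(ℝ≥0, ℝ))] at h

end Lift

/-! ### Measurability of the exit functionals on path space -/

section Measurability

variable [MeasurableSpace C(ℝ≥0, ℝ)] [BorelSpace C(ℝ≥0, ℝ)]

/-- The evaluations `p ↦ p t` are Borel measurable on `C(ℝ≥0, ℝ)`. [folklore] -/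
theorem measurable_coordProcess (t : ℝ≥0) : Measurable (coordProcess t) :=
  (continuous_eval_const t).measurable

/-- The evaluations are strongly measurable. [folklore] -/
theorem stronglyMeasurable_coordProcess (t : ℝ≥0) : StronglyMeasurable (coordProcess t) :=
  (measurable_coordProcess t).stronglyMeasurable

/-- The coordinate map `(t, p) ↦ p t` is jointly measurable. [folklore] -/
theorem measurable_uncurry_coordProcess : Measurable (Function.uncurry coordProcess) :=
  measurable_uncurry_of_continuous_of_measurable (fun p ↦ continuous_coordProcess p)
    measurable_coordProcess

/-- The **natural filtration of the coordinate process** on `C([0, ∞), ℝ)` (raw, Mathlib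
`Filtration.natural`). Billingsley (1999), §7. [folklore] -/
def coordFiltration : Filtration ℝ≥0 (‹MeasurableSpace C(ℝ≥0, ℝ)›) :=
  Filtration.natural (β := fun _ ↦ ℝ) (fun t ↦ coordProcess t) stronglyMeasurable_coordProcess

/-- The coordinate process is adapted to its natural filtration. [folklore] -/
theorem adapted_coordProcess : Adapted coordFiltration coordProcess :=
  (Filtration.stronglyAdapted_natural (β := fun _ ↦ ℝ) stronglyMeasurable_coordProcess).adapted

/-- The coordinate process is strongly adapted to its natural filtration. [folklore] -/
theorem stronglyAdapted_coordProcess : StronglyAdapted coordFiltration coordProcess :=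
  Filtration.stronglyAdapted_natural (β := fun _ ↦ ℝ) stronglyMeasurable_coordProcess

/-- **The path exit time of `(a, b)` is a stopping time** of the natural filtration of the
coordinate process (continuous paths, closed target). Revuz–Yor (1999), Ch. I, Prop. (4.6).
[folklore] -/
theorem isStoppingTime_pathExitTime (a b : ℝ) : IsStoppingTime coordFiltration (pathExitTime a b) :=
  Process.isStoppingTime_exitTime adapted_coordProcess continuous_coordProcess

/-- The path exit time is Borel measurable. [folklore] -/
theorem measurable_pathExitTime (a b : ℝ) : Measurable (pathExitTime a b) :=
  (isStoppingTime_pathExitTime a b).measurable'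

/-- The event "the path never exits `(a, b)`" is measurable. [folklore] -/
theorem measurableSet_pathExitTime_eq_top (a b : ℝ) : MeasurableSet {p | pathExitTime a b p = ⊤} :=
  (isStoppingTime_pathExitTime a b).measurableSet_eq_top

/-- The real-valued path exit time is measurable. [folklore] -/
theorem measurable_pathExitTimeReal (a b : ℝ) : Measurable (pathExitTimeReal a b) :=
  ((measurable_pathExitTime a b).untopD _).coe_nnreal_real

/-- The path exit value is Borel measurable (Mathlib `measurable_stoppedValue` for the
progressively measurable coordinate process). [folklore] -/
theorem measurable_pathExitValue (a b : ℝ) : Measurable (pathExitValue a b) :=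
  (measurable_stoppedValue
    (StronglyAdapted.isStronglyProgressive_of_continuous stronglyAdapted_coordProcess
      continuous_coordProcess) (isStoppingTime_pathExitTime a b)).mono
    ((isStoppingTime_pathExitTime a b).measurableSpace_le) le_rfl

/-- Evaluation of a path at a measurable random time is measurable. [folklore] -/
theorem measurable_coordProcess_randomTime {ρ : C(ℝ≥0, ℝ) → ℝ≥0} (hρ : Measurable ρ) :
    Measurable fun p : C(ℝ≥0, ℝ) ↦ p (ρ p) :=
  measurable_uncurry_coordProcess.comp (hρ.prodMk measurable_id)

/-- The shifted path at a measurable random time is a measurable path-valued map. [folklore] -/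
theorem measurable_shiftPath_randomTime {ρ : C(ℝ≥0, ℝ) → ℝ≥0} (hρ : Measurable ρ) :
    Measurable fun p : C(ℝ≥0, ℝ) ↦ shiftPath (ρ p) p := by
  refine measurable_toPathC (Y := fun u (p : C(ℝ≥0, ℝ)) ↦ p (ρ p + u) - p (ρ p)) (fun p ↦ ?_)
    (fun u ↦ ?_)
  · exact (p.continuous.comp (continuous_const.add continuous_id)).sub continuous_const
  · exact (measurable_coordProcess_randomTime (hρ.add_const u)).sub
      (measurable_coordProcess_randomTime hρ)

/-- **The post-exit path is a measurable path-valued functional.** [folklore] -/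
theorem measurable_postExitPath (a b : ℝ) : Measurable (postExitPath a b) :=
  measurable_shiftPath_randomTime (measurable_pathExitTime a b).untopA

/-- **The pre-exit path is a measurable path-valued functional.** [folklore] -/
theorem measurable_preExitPath (a b : ℝ) : Measurable (preExitPath a b) := by
  refine measurable_toPathC
    (Y := fun u (p : C(ℝ≥0, ℝ)) ↦ p (min (u : WithTop ℝ≥0) (pathExitTime a b p)).untopA)
    (fun p ↦ p.continuous.comp (Process.continuous_untopA_min_coe _)) (fun u ↦ ?_)
  exact measurable_coordProcess_randomTime ((measurable_const.min (measurable_pathExitTime a b)).untopA)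

end Measurability

/-! ### Transfer of laws from `ℝ≥0 → ℝ` to `C(ℝ≥0, ℝ)` -/

section Transfer

variable [MeasurableSpace C(ℝ≥0, ℝ)] [BorelSpace C(ℝ≥0, ℝ)]

/-- Every Borel set of `C(ℝ≥0, ℝ)` is the trace of a product-measurable set of `ℝ≥0 → ℝ` (the
Borel σ-algebra of the compact-open topology is the pull-back of the product σ-algebra under
the coercion). Billingsley (1999), Example 1.3. [folklore] -/
theorem exists_measurableSet_pi_preimage_eq {s : Set C(ℝ≥0, ℝ)} (hs : MeasurableSet s) :
    ∃ t : Set (ℝ≥0 → ℝ), MeasurableSet t ∧ (fun (f : C(ℝ≥0, ℝ)) (a : ℝ≥0) ↦ f a) ⁻¹' t = s := by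
  have hs' : MeasurableSet[MeasurableSpace.pi.comap fun (f : C(ℝ≥0, ℝ)) (a : ℝ≥0) ↦ f a] s := by
    rw [← Process.iSup_comap_eval_eq_comap_pi, ← Process.borel_continuousMap_eq_iSup_comap_eval,
      ← BorelSpace.measurable_eq (α := C(ℝ≥0, ℝ))]
    exact hs
  exact MeasurableSpace.measurableSet_comap.1 hs'

variable {Ω Ω' : Type*} {mΩ : MeasurableSpace Ω} {mΩ' : MeasurableSpace Ω'}
  {μ : Measure Ω} {μ' : Measure Ω'}

/-- **Transfer lemma**: two continuous-path processes (with measurable marginals) whose laws on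
`ℝ≥0 → ℝ` (product σ-algebra) agree have the same law as random elements of `C([0, ∞), ℝ)`.
Billingsley (1999), §7 (the finite-dimensional sets form a separating class). [folklore] -/
theorem identDistrib_toPathC {Y : ℝ≥0 → Ω → ℝ} {Y' : ℝ≥0 → Ω' → ℝ}
    (hY : ∀ ω, Continuous fun t ↦ Y t ω) (hY' : ∀ ω, Continuous fun t ↦ Y' t ω)
    (hm : ∀ t, Measurable (Y t)) (hm' : ∀ t, Measurable (Y' t))
    (h : IdentDistrib (fun ω t ↦ Y t ω) (fun ω t ↦ Y' t ω) μ μ') :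
    IdentDistrib (toPathC Y hY) (toPathC Y' hY') μ μ' := by
  refine ⟨(measurable_toPathC hY hm).aemeasurable, (measurable_toPathC hY' hm').aemeasurable, ?_⟩
  ext s hs
  obtain ⟨t, ht, rfl⟩ := exists_measurableSet_pi_preimage_eq hs
  rw [Measure.map_apply (measurable_toPathC hY hm) hs,
    Measure.map_apply (measurable_toPathC hY' hm') hs]
  exact h.measure_mem_eq ht

end Transfer

end Literature.Probability.RandomPlanarGeometry
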